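import Summits.CriticalPhenomena.PercolationContinuityZ3.Theorems.Transplant.SkelConcRoot
import Summits.CriticalPhenomena.PercolationContinuityZ3.Theorems.Transplant.SkelDeepRoute
import Summits.CriticalPhenomena.PercolationContinuityZ3.Theorems.Transplant.KNLevelsEntrance
import Literature.Probability.Percolation.TreeGraphBound
import HarnessLib

/-!
# L6 (R): the FIRST HOP of the root run over a `PlanarSkeletonConc` — under the root law cut to a world `U' ⊇` (a window over) the wired
# root cube, the root `w₀` is joined to the quarter-face `macroPiece c ℓ (ψ ℓ) g` of an OFF-CENTRE first-hop prism `fatSeq c ℓ ⊆ U'` with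
# probability `> 1 − δ`, given the Lemma-9 link at the running parameter at the centre `c` (p3-g4's `link_seed_center_of_le`, weights `≥ q`
# on the prism), a WIRED WALK from `w₀` to `c` inside the root-cube window (field (ι) `step`, planar box convexity) and the seed prism
# `fatSeq c k` inside that window (all their edges are edges of the wired cube `U₀`, hence almost surely open) — generic twin of p3-g2's
# `BoxProdZ2ConcRootHop` (`root_hsrc`), where the product cube `B(w₀,rQ) × C.Q 0` was internally connected for free

builds on p205010 (kernel theorem, internal audit signed; external expert review pending) — nothing in this file uses p205010.
Status sentence (coordinator 2026-08-20T04:30Z): "θ(p_c) = 0 on ℤ^d, all d ≥ 2 — kernel-verified (Lean 4/Mathlib, standard axioms); internal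
adversarial audit SIGNED 2026-08-20 04:29Z; external expert review pending."
Lane `prim-bschramm-*`, seat `prim-bschramm-p2` (gen 4; (R) = p2 lineage); helper file (`--supports stmt-CriticalPhenomena-4575`).

WHY A WALK: over a skeleton the span `Q_0 = VWin w₀ (C.Q 0) rQ` of the root-cube window is NOT internally connected from `w₀` in general
(full-depth vertices whose inside neighbours sit across the planar boundary), so the wired cluster of the root is only its component; the
off-centre first-hop prism (centre `c` over the planar point `rootV`, KNCellsBoxProdZ2ConcRootGB) is put into that component by an explicit
planar step-walk `w₀ ↝ c` inside the window `Win w₀ (Icc lo hi) n` (`exists_wiredWalk`: ℓ¹-induction as in p3-g4's `exists_mem_graphBall_φ_eq`,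
the box being monotone-path convex).
* §1 `Skel.W0sub_eq_one_of_mem_U₀`, `Skel.le_W0sub_of_mem`, `Skel.W0sub_ae_open` (any lag-1 scheme);
* §2 `PlanarSkeletonConc.exists_wiredWalk`;
* §3 **`Skel.root_hsrc_of_walk`** — the first hop from a wired, internally connected source containing the seed;
  **`Skel.root_hsrcSG`** — for the scheme of record: walk + seed inside `Win w₀ (C.Q 0) R₀` with `R₀ ≤ rQ 0 0`, prism inside `U'`.
[cite: KozmaNitzan2024, §4 p. 27 (G₀: the wired cube), p. 28 ((32) at the root), Lemma 9 (p. 16), Lemma 11 (p. 23)]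
-/

noncomputable section

open MeasureTheory
open scoped Classical

namespace Summit.CriticalPhenomena.PercolationContinuityZ3.Theorems

namespace Transplant

/-! ## §1 The cut root law: wired cube edges, weights `≥ q` inside the world -/

namespace Skel

open Literature.Probability.Percolation Literature.Probability.LatticeModels SimpleGraph KNCells KNLevels
open Literature.Probability.Percolation.KozmaNitzan (wireSet_mono)

variable {V : Type} [DecidableEq V] {G : SimpleGraph V} [G.LocallyFinite]
variable {A : Type*} {S : KSchA V A}

/-- On a pair inside `U'` that is an edge of the wired root cube the cut root law is `1`. [cite: KozmaNitzan2024, §4 p. 27 (G₀)] -/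
theorem W0sub_eq_one_of_mem_U₀ {U' : Finset V} {e : Sym2 V} (heU : e ∈ wireSet (↑U' : Set V)) (he : e ∈ S.U₀ G) :
    S.W0sub G U' e = 1 := by
  unfold KSchA.W0sub
  rw [restrW_apply_of_mem _ heU]
  exact pinW_apply_of_mem_of_mem _ (Finset.mem_coe.2 he) (Finset.mem_coe.2 he)

/-- Inside `U'` the cut root law is `≥ q` on the edges of `G`. [folklore] -/
theorem le_W0sub_of_mem {U' : Finset V} {u u' : V} (hu : u ∈ U') (hu' : u' ∈ U') (hadj : G.Adj u u') :
    S.p ≤ S.W0sub G U' s(u, u') := by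
  have hw : s(u, u') ∈ wireSet (↑U' : Set V) := mk_mem_wireSet_iff.2 ⟨Finset.mem_coe.2 hu, Finset.mem_coe.2 hu', hadj.ne⟩
  by_cases h0 : s(u, u') ∈ S.U₀ G
  · rw [W0sub_eq_one_of_mem_U₀ hw h0]; exact unitInterval.le_one _
  · rw [KSchA.W0sub_apply_of_mem hw h0, KNLevels.lattW_apply, if_pos ((SimpleGraph.mem_edgeSet G).2 hadj)]

/-- **The wired cube's edges inside `U'` are almost surely open** under the cut root law. [cite: KozmaNitzan2024, §4 p. 27 (G₀)] -/
theorem W0sub_ae_open [Countable V] (U' : Finset V) :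
    ∀ᵐ ω ∂prodBernoulli (S.W0sub G U'), ∀ u u', u ∈ (↑U' : Set V) → u' ∈ (↑U' : Set V) → s(u, u') ∈ S.U₀ G → s(u, u') ∈ ω := by
  have key : ∀ e' : Sym2 V, ∀ᵐ ω ∂prodBernoulli (S.W0sub G U'), S.W0sub G U' e' = 1 → e' ∈ ω := by
    intro e'
    by_cases he : S.W0sub G U' e' = 1
    · filter_upwards [prodBernoulli_ae_mem_of_eq_one _ he] with ω hω _ using hω
    · exact Filter.Eventually.of_forall fun ω h' => absurd h' he
  rw [← ae_all_iff] at key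
  filter_upwards [key] with ω hω u u' hu hu' h0
  have hne : u ≠ u' := by
    intro h; subst h
    rw [KSchA.U₀, mem_edgesIn_iff] at h0
    exact G.irrefl ((SimpleGraph.mem_edgeSet G).1 h0.1)
  exact hω _ (W0sub_eq_one_of_mem_U₀ (mk_mem_wireSet_iff.2 ⟨hu, hu', hne⟩) h0)

end Skel

/-! ## §2 A wired planar walk inside a box window -/

namespace PlanarSkeletonConc

open Literature.Probability.Percolation Literature.Probability.LatticeModels SimpleGraph
open Literature.Barriers.CriticalPhenomena (graphBall mem_graphBall_self graphBall_mono)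

variable {V : Type} [DecidableEq V] {G : SimpleGraph V} [G.LocallyFinite] (Φ : PlanarSkeletonConc G)

/-- **A step-walk from `w₀` to a vertex over `x₀` inside the box window**: if `φ w₀` and `x₀` lie in the box `Icc lo hi`, there are a
vertex `c` with `φ c = x₀` and a finite set `Wk ∋ w₀, c` of vertices inside `Win w₀ (Icc lo hi) ‖x₀ − φ w₀‖₁`, every one of which is joined
to `w₀` by a `G`-path inside `Wk` (ℓ¹-induction with the field (ι) `step`; the box is monotone-path convex).
[cite: KozmaNitzan2024, §4 p. 27 (G₀), p. 26 ((29))] -/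
theorem exists_wiredWalk (w₀ : V) {lo hi : Site 2} (h0 : Φ.φ w₀ ∈ Finset.Icc lo hi) (x₀ : Site 2) (hx : x₀ ∈ Finset.Icc lo hi) :
    ∃ (c : V) (Wk : Finset V), Φ.φ c = x₀ ∧ c ∈ Wk ∧ w₀ ∈ Wk ∧
      Wk ⊆ Φ.Win w₀ (Finset.Icc lo hi) ((x₀ 0 - Φ.φ w₀ 0).natAbs + (x₀ 1 - Φ.φ w₀ 1).natAbs) ∧ ∀ s ∈ Wk, PathIn G (↑Wk : Set V) w₀ s := by
  suffices h : ∀ (n : ℕ) (y : Site 2), y ∈ Finset.Icc lo hi → (y 0 - Φ.φ w₀ 0).natAbs + (y 1 - Φ.φ w₀ 1).natAbs = n →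
      ∃ (c : V) (Wk : Finset V), Φ.φ c = y ∧ c ∈ Wk ∧ w₀ ∈ Wk ∧ Wk ⊆ Φ.Win w₀ (Finset.Icc lo hi) n ∧
        ∀ s ∈ Wk, PathIn G (↑Wk : Set V) w₀ s from h _ x₀ hx rfl
  intro n
  induction n with
  | zero =>
    intro y hy hn
    have hy0 : (y 0 - Φ.φ w₀ 0).natAbs = 0 := by omega
    have hy1 : (y 1 - Φ.φ w₀ 1).natAbs = 0 := by omega
    have hyw : Φ.φ w₀ = y := by
      funext i
      fin_cases i
      · exact (sub_eq_zero.1 (Int.natAbs_eq_zero.1 hy0)).symm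
      · exact (sub_eq_zero.1 (Int.natAbs_eq_zero.1 hy1)).symm
    have hmem : w₀ ∈ Φ.Win w₀ (Finset.Icc lo hi) 0 := Φ.mem_Win.2 ⟨mem_graphBall_self G w₀ 0, h0⟩
    refine ⟨w₀, {w₀}, hyw, Finset.mem_singleton_self _, Finset.mem_singleton_self _, Finset.singleton_subset_iff.2 hmem, ?_⟩
    intro s hs
    rw [Finset.mem_singleton] at hs
    subst hs
    exact PathIn.refl (by simp)
  | succ n ih =>
    intro y hy hn
    have hex : ∃ i : Fin 2, y i ≠ Φ.φ w₀ i := by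
      by_contra hcon
      push Not at hcon
      have := hcon 0; have := hcon 1
      simp_all
    obtain ⟨i, hne⟩ := hex
    set σ : ℤˣ := if Φ.φ w₀ i < y i then 1 else -1 with hσdef
    set y' : Site 2 := y - Pi.single i (σ : ℤ) with hy'def
    have hy'i : y' i = y i - (σ : ℤ) := by simp [hy'def]
    have hy'j : ∀ j, j ≠ i → y' j = y j := by intro j hj; simp [hy'def, hj]
    have hσ : (Φ.φ w₀ i < y i ∧ (σ : ℤ) = 1) ∨ (y i < Φ.φ w₀ i ∧ (σ : ℤ) = -1) := by
      by_cases hlt : Φ.φ w₀ i < y i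
      · exact Or.inl ⟨hlt, by rw [hσdef, if_pos hlt]; rfl⟩
      · exact Or.inr ⟨lt_of_le_of_ne (not_lt.1 hlt) hne, by rw [hσdef, if_neg hlt]; rfl⟩
    have hdist : (y' 0 - Φ.φ w₀ 0).natAbs + (y' 1 - Φ.φ w₀ 1).natAbs = n := by
      have key : (y' i - Φ.φ w₀ i).natAbs + 1 = (y i - Φ.φ w₀ i).natAbs := by
        rw [hy'i]; rcases hσ with ⟨h1, h2⟩ | ⟨h1, h2⟩ <;> rw [h2] <;> omega
      fin_cases i
      · have h1 := hy'j 1 (by decide)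
        simp only [Fin.zero_eta] at key
        rw [h1]; omega
      · have h0' := hy'j 0 (by decide)
        simp only [Fin.mk_one] at key
        rw [h0']; omega
    -- the intermediate point stays in the box (between `y i` and `φ w₀ i` in coordinate `i`)
    have hy'box : y' ∈ Finset.Icc lo hi := by
      rw [Literature.Probability.Percolation.KozmaNitzan.mem_Icc_iff] at hy h0 ⊢
      intro j
      by_cases hj : j = i
      · rw [hj, hy'i]
        obtain ⟨h5, h6⟩ := hy i
        obtain ⟨h7, h8⟩ := h0 i
        rcases hσ with ⟨h1, h2⟩ | ⟨h1, h2⟩ <;> rw [h2] <;> constructor <;> omega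
      · rw [hy'j j hj]; exact hy j
    obtain ⟨c', Wk', hφc', hc', hw₀, hWk', hpath⟩ := ih y' hy'box hdist
    obtain ⟨c, hadj, hφc⟩ := Φ.step c' i σ
    have hφcy : Φ.φ c = y := by rw [hφc, hφc', hy'def, sub_add_cancel]
    have hcWin : c ∈ Φ.Win w₀ (Finset.Icc lo hi) (n + 1) := by
      have hc'ball : c' ∈ graphBall G w₀ n := (Φ.mem_Win.1 (hWk' hc')).1
      exact Φ.mem_Win.2 ⟨BoxProdZ2.mem_graphBall_succ_of_adj G hc'ball hadj, hφcy ▸ hy⟩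
    refine ⟨c, insert c Wk', hφcy, Finset.mem_insert_self _ _, Finset.mem_insert_of_mem hw₀, ?_, ?_⟩
    · exact Finset.insert_subset hcWin (hWk'.trans (Φ.Win_mono subset_rfl (Nat.le_succ n)))
    · intro s hs
      have hsub : (↑Wk' : Set V) ⊆ ↑(insert c Wk') := Finset.coe_subset.2 (Finset.subset_insert _ _)
      rcases Finset.mem_insert.1 hs with rfl | hs
      · exact ((hpath c' hc').mono hsub).tail hadj (by simp)
      · exact (hpath s hs).mono hsub

end PlanarSkeletonConc

/-! ## §3 The first hop of the root run -/

namespace Skel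

open Literature.Probability.Percolation Literature.Probability.LatticeModels SimpleGraph KNCells KNLevels PlanarSkeletonConc
open Literature.Probability.Percolation.GM (HOct)
open Literature.Probability.Percolation.KozmaNitzan (wireSet_mono)
open Literature.Barriers.CriticalPhenomena (graphBall mem_graphBall_self graphBall_mono)
open BoxProdZ2 (ConcRadiiG)

variable {V : Type} [DecidableEq V] [Countable V] {G : SimpleGraph V} [G.LocallyFinite] (Φ : PlanarSkeletonConc G)

omit [DecidableEq V] [Countable V] [G.LocallyFinite] Φ in
/-- Monotonicity of `μ.real` along an almost-sure implication (finite measures). [folklore] -/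
private theorem measureReal_mono_ae' {α : Type*} [MeasurableSpace α] {μ : Measure α} [IsFiniteMeasure μ] {s t : Set α}
    (h : ∀ᵐ x ∂μ, x ∈ s → x ∈ t) : μ.real s ≤ μ.real t := by
  rw [measureReal_def, measureReal_def]
  exact ENNReal.toReal_mono (measure_ne_top _ _) (measure_mono_ae h)

variable {A : Type*} {S : KSchA V A}

/-- **The first hop from a wired, internally connected source** (generic): under the cut root law `W0sub U'`, with a link input at the
centre `c` at scales `(ℓ, k)` (event `fatSeq c k ↔ macroPiece c ℓ (ψ ℓ) g` inside `fatSeq c ℓ`) valid for `P_q`, the prism `fatSeq c ℓ ⊆ U'`,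
and a finite `Sw ⊆ U'` with `fatSeq c k ⊆ Sw`, every vertex of `Sw` joined to the root `o` inside `Sw`, and every `G`-edge inside `Sw` an edge of
the wired cube `U₀`: `1 − δ < P_{W0sub U'}(⋃_{t ∈ face} o ↔ t)`. [cite: KozmaNitzan2024, §4 p. 28 ((32) at the root), Lemma 9 (p. 16)] -/
theorem root_hsrc_of_walk {p : unitInterval} (hC : Φ.toPlanarSkeleton.CylSubcritical p) {U' Sw : Finset V} {o c : V} {ℓ k : ℕ}
    {δ : ℝ} {g : HOct 2}
    (hlink : 1 - δ < (bondPercolation G S.p).real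
      (linkIn (↑(fatSeq Φ hC c ℓ)) (fatSeq Φ hC c k) (macroPiece Φ c ℓ (fatRadius Φ hC ℓ) g)))
    (hℓU : fatSeq Φ hC c ℓ ⊆ U') (hSwU : Sw ⊆ U') (hkS : fatSeq Φ hC c k ⊆ Sw)
    (hconn : ∀ s ∈ Sw, PathIn G (↑Sw : Set V) o s) (hwired : ∀ u ∈ Sw, ∀ u' ∈ Sw, G.Adj u u' → s(u, u') ∈ S.U₀ G) :
    1 - δ < (prodBernoulli (S.W0sub G U')).real (⋃ t ∈ macroPiece Φ c ℓ (fatRadius Φ hC ℓ) g, openConn o t) := by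
  set μ := prodBernoulli (S.W0sub G U') with hμ
  set T := macroPiece Φ c ℓ (fatRadius Φ hC ℓ) g with hT
  -- Lemma 9 under the cut root law (weights `≥ q` inside `U'`), seed enlarged to the wired source `Sw`
  have h1 : 1 - δ < μ.real (linkIn (↑(fatSeq Φ hC c ℓ)) Sw T) :=
    link_seed_center_of_le Φ hC (fun u hu u' hu' hadj => le_W0sub_of_mem (hℓU hu) (hℓU hu') hadj) hlink hkS subset_rfl
  -- enlarge the ambient set of the link to `U'`
  have h2 : 1 - δ < μ.real (linkIn (↑U' : Set V) Sw T) :=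
    h1.trans_le (measureReal_mono (linkIn_mono (Finset.coe_subset.2 hℓU) subset_rfl subset_rfl) (measure_ne_top _ _))
  refine lt_of_lt_of_le h2 (measureReal_mono_ae' ?_)
  filter_upwards [W0sub_ae_open (S := S) (G := G) U'] with ω hopen hω
  have h3 := linkIn_subset_biUnion_openConnIn_of_wired (G := G) (Finset.coe_subset.2 hSwU) (o := o) hconn
    (fun a b ha hb hab => hopen a b (hSwU (Finset.mem_coe.1 ha)) (hSwU (Finset.mem_coe.1 hb))
      (hwired a (Finset.mem_coe.1 ha) b (Finset.mem_coe.1 hb) hab)) hω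
  simp only [Set.mem_iUnion, exists_prop] at h3 ⊢
  obtain ⟨t, ht, h4⟩ := h3
  exact ⟨t, ht, openConnIn_subset_openConn _ _ _ h4⟩

/-- **THE FIRST HOP OF THE ROOT RUN for the scheme of record** `⟨Skel.cellGeomSG Φ C w₀ Λ, q, δc⟩`: the wired source is a step-walk
from `w₀` to a vertex `c` over `x₀ ∈ C.Q 0` together with the seed prism `fatSeq c k`, both inside the root-cube window `Win w₀ (C.Q 0) R₀`
with `R₀ ≤ rQ 0 0` (so all their inside edges are edges of the wired cube), and the first-hop prism `fatSeq c ℓ` lies in the cut root world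
`U' ⊇ Win w₀ (C.Q 0) R₀`.  [cite: KozmaNitzan2024, §4 p. 28 ((32) at the root), Lemma 9 (p. 16)] -/
theorem root_hsrcSG (C : PCells) (w₀ : V) {Λ : ConcRadiiG} (hφ : Φ.φ w₀ = 0) {q : unitInterval} {δc : ℝ}
    {p : unitInterval} (hC : Φ.toPlanarSkeleton.CylSubcritical p) {U' : Finset V} {x₀ : Site 2} (hx₀ : x₀ ∈ C.Q 0)
    {R₀ : ℕ} (hR₀Q : R₀ ≤ Λ.rQ 0 0) (hWU : Φ.Win w₀ (C.Q 0) R₀ ⊆ U') {ℓ : ℕ} {δ : ℝ} {g : HOct 2}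
    (hlink : ∀ c, Φ.φ c = x₀ → c ∈ graphBall G w₀ ((x₀ 0).natAbs + (x₀ 1).natAbs) →
      ∃ k, fatSeq Φ hC c k ⊆ Φ.Win w₀ (C.Q 0) R₀ ∧ 1 - δ < (bondPercolation G q).real
        (linkIn (↑(fatSeq Φ hC c ℓ)) (fatSeq Φ hC c k) (macroPiece Φ c ℓ (fatRadius Φ hC ℓ) g)))
    (hn : (x₀ 0).natAbs + (x₀ 1).natAbs ≤ R₀)
    (hℓU : ∀ c, Φ.φ c = x₀ → c ∈ graphBall G w₀ ((x₀ 0).natAbs + (x₀ 1).natAbs) → fatSeq Φ hC c ℓ ⊆ U') :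
    ∃ c, Φ.φ c = x₀ ∧ c ∈ graphBall G w₀ ((x₀ 0).natAbs + (x₀ 1).natAbs) ∧
      1 - δ < (prodBernoulli ((⟨cellGeomSG Φ C w₀ Λ, q, δc⟩ : KSchA V ℕ).W0sub G U')).real
        (⋃ t ∈ macroPiece Φ c ℓ (fatRadius Φ hC ℓ) g, openConn w₀ t) := by
  set S' : KSchA V ℕ := ⟨cellGeomSG Φ C w₀ Λ, q, δc⟩ with hS'
  -- the walk inside the root-cube box
  have h0 : Φ.φ w₀ ∈ C.Q 0 := by rw [hφ]; exact C.zero_mem_Q_zero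
  obtain ⟨c, Wk, hφc, hc, hw₀, hWk, hpath⟩ := Φ.exists_wiredWalk w₀ (lo := C.cen 0 - ((5 * C.r : ℕ) : Site 2))
    (hi := C.cen 0 + ((5 * C.r : ℕ) : Site 2)) h0 x₀ hx₀
  simp only [hφ, Pi.zero_apply, sub_zero] at hWk
  have hcball : c ∈ graphBall G w₀ ((x₀ 0).natAbs + (x₀ 1).natAbs) := (Φ.mem_Win.1 (hWk hc)).1
  obtain ⟨k, hkQ, hlk⟩ := hlink c hφc hcball
  have hWkQ : Wk ⊆ Φ.Win w₀ (C.Q 0) R₀ := hWk.trans (Φ.Win_mono subset_rfl hn)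
  refine ⟨c, hφc, hcball, root_hsrc_of_walk Φ hC (S := S') (Sw := Wk ∪ fatSeq Φ hC c k) hlk (hℓU c hφc hcball) ?_
    Finset.subset_union_right ?_ ?_⟩
  · -- the wired source `Wk ∪ fatSeq c k` lies in `U'`
    exact Finset.union_subset (hWkQ.trans hWU) (hkQ.trans hWU)
  · -- every vertex of the source is joined to `w₀` inside it: along the walk to `c`, then inside the seed prism
    intro s hs
    have hsubW : (↑Wk : Set V) ⊆ ↑(Wk ∪ fatSeq Φ hC c k) := Finset.coe_subset.2 Finset.subset_union_left
    have hsubK : (↑(fatSeq Φ hC c k) : Set V) ⊆ ↑(Wk ∪ fatSeq Φ hC c k) := Finset.coe_subset.2 Finset.subset_union_right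
    rcases Finset.mem_union.1 hs with hs | hs
    · exact (hpath s hs).mono hsubW
    · have hcs : PathIn G (↑(fatSeq Φ hC c k) : Set V) c s := by
        have h' := pathIn_cylBall Φ ((mem_fatSeq_iff Φ hC).1 hs)
        refine h'.mono fun v hv => ?_
        exact Finset.mem_coe.2 ((mem_fatSeq_iff Φ hC).2 hv)
      exact ((hpath c hc).mono hsubW).trans (hcs.mono hsubK)
  · -- every edge inside the source is an edge of the wired cube `edgesIn (Q_0)` (window ⊆ span-window, `R₀ ≤ rQ 0 0`)
    intro u hu u' hu' hadj
    have hW : ∀ v ∈ Wk ∪ fatSeq Φ hC c k, v ∈ Φ.Win w₀ (C.Q 0) (Λ.rQ 0 0) := fun v hv => by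
      rcases Finset.mem_union.1 hv with hv | hv
      · exact Φ.Win_mono subset_rfl hR₀Q (hWkQ hv)
      · exact Φ.Win_mono subset_rfl hR₀Q (hkQ hv)
    change s(u, u') ∈ edgesIn G (Φ.VWin w₀ (C.Q 0) (Λ.rQ 0 0))
    rw [edgesIn_VWin, mem_edgesIn_iff]
    refine ⟨(SimpleGraph.mem_edgeSet G).2 hadj, fun v hv => ?_⟩
    rcases Sym2.mem_iff.1 hv with rfl | rfl
    · exact hW _ hu
    · exact hW _ hu'

end Skel

end Transplant

end Summit.CriticalPhenomena.PercolationContinuityZ3.Theorems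

end
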